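import Literature.MathematicalPhysics.QuantumFieldTheory.Balaban1983to89.B11Thm1ExistsUniqueRealisedDataB
import Literature.MathematicalPhysics.QuantumFieldTheory.Balaban1983to89.B11Thm1ExistsUniqueTokensGBBridges
import Literature.MathematicalPhysics.QuantumFieldTheory.Balaban1983to89.B11Thm1ExistsUniqueTruncationData
import Literature.MathematicalPhysics.QuantumFieldTheory.Balaban1983to89.Node00.CriticalOnFibreTopGuardedBPrint
import Literature.MathematicalPhysics.QuantumFieldTheory.Balaban1983to89.Node00.CriticalOnFibreTopCore

/-!
# `Balaban1983to89.B11Thm1ExistsUniqueRealisedDataBBridges` — [Balaban1985Variational] = «[15]», (7) p. 278, (11)–(14) pp. 279–280: THE BOOKKEEPING OF REGULAR-REALISED DATA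
# (`B11Thm1ExistsUniqueRealisedDataB.DataRegularRealisedTop`): both typed readings of (7) follow, the predicate is hereditary under print's truncation, the co-divergence of a
# plaquette-small field through its stencil, and ★★ THE SUPPLY TOKEN AT LENGTH 1 («we take simply U₀ = V₀», p. 280) OVER `(lamDatum F, dataRegularRealisedTopOf F N)` — PROVED

Honest framing: statement-level skeleton of published theorems with citation tags; proofs where landed; nothing here is a claim about the Yang–Mills mass gap.  Cell `pub-ymgap`
(HUMAN RULINGS D-0062 ∕ D-0149), lane `pub-ymgap-dag-n12-c` g38 (R134 seat (a), N12 = [B15], s1).  `--kind proof --supports` K1⁹ `stmt-QuantumFields-27364`; count-neutral; THEOREMS ONLY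
(0 `def`, 0 `sorry`, 0 `instance`); the definitions are the sibling STATEMENT-ONLY module `B11Thm1ExistsUniqueRealisedDataB`.  The LIFT token's body over regular-realised data (print's
(11)–(13)) and the induction «(E∕U)ᴮ ⇐ STEPᴮ ∧ (R)ᴮ at regular-realised data» read the Summits-side index geometry of `Averaging.local_dep` (the `k`-bonds read at a constrained
`(k+1)`-bond lie in `Ω_k`) and are the Summits sibling `Summit.…Theorems.BalabanUVNodesN12EUStepTokensAtRealisedDataLam`.

CONTENTS.
* §1 accessors `DataRegularRealisedTop.real ∕ .plaq₀ ∕ .plaq₁ ∕ .plaqLevel`, `.of_le` (weakening the thresholds).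
* §2 ★ BOTH READINGS OF (7) FOLLOW: for realised data the (7) field spliced with `V̄ = M(W_m)` IS the datum (`mixedField_eq_of_real`, `mixedFieldB_eq_of_real`), and the (7) ranges lie in
  the full ranges (`plaqsOf_genSet_subset_plaqsOf_pts`); `DataRegularRealisedTop.toPTop ∕ .toLamTop`; the `TopData` corollaries `dataSmall7PTopOf_of_dataRegularRealisedTopOf`,
  `dataSmall7LamTopOf_of_dataRegularRealisedTopOf` (the pointwise implications `.of_imp_dat` consumes: every token ∕ name typed over `dataSmall7PTopOf` or `dataSmall7LamTopOf` serves
  the regular-realised datum).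
* §3 ★ HEREDITY UNDER PRINT's TRUNCATION `truncSeq` (SAME thresholds): `DataRegularRealisedTop.truncSeq` — (11)'s «V₀ satisfies (7) on 𝔅′_{k−1}» for `V₀ := V`.
* §4 ★ THE CO-DIVERGENCE THROUGH THE STENCIL: `coDivSmallOn_bondsOf_of_plaqSmallOn_plaqsOf` — [6] (1.9) on the bonds meeting `S` from (1.7) on the plaquettes meeting `S` with the
  constant `2d` (`Node00.Sect2.norm_coDivSum_le_of_stencil`: every stencil plaquette of a bond contains both its end-points).
* §5 ★★ THE SUPPLY TOKEN AT LENGTH 1 OVER `(lamDatum F, dataRegularRealisedTopOf F N)`, ANY GUARD, ANY SELECTOR: `approxMinTopB_lengthOne_of_realised` ((14) at `k = 1` for `U₀ := W 0`: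
  plaquettes at scale 0 ∕ 1 from (F₀) ∕ (F₁), co-divergence by §4, agreement on `Λ₀` by `M⁰ = id` and on `Λ₁` by (R)), ★★ `approxMinimiserExistsTop7MGB_lengthOne_realised` ∕ `…CoP7MGB…`
  — the `hbase` input of `…TokensGBBridges.variationalThm1EUSep{Top,CoP}7MGB_of_step_of_reg_of_base_of_lift`, for every `C₁, B₃` with `8L³ < C₁B₃`.

HONEST SCOPE.  Bookkeeping over landed kernel theorems; nothing of [15]'s analysis asserted; the ONE-LENGTH STEP token ([15] Prop. 2 + Sects. B–E) stays OPEN (N07); `stub_prop8StepCoPGridG13`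
∕ K0⁷ NOT closed; K1⁹ OPEN; N12 NOT discharged; counts unmoved (discharged 8∕27); one finite 𝕋⁴ programme at fixed ε — the route closes the conditional finite-𝕋⁴ rung `BalabanLadder.UV`
only; nothing continuum ∕ ℝ⁴ ∕ OS; the Yang–Mills mass gap (Clay) is NOT proved by any of this.

References: [15] = [Balaban1985Variational] (2)–(7) p.278, Thm 1 p.279, (11) p.279, (12)–(14) p.280; [6] = [Balaban1985RegularSpaces] (1.1)–(1.2) p.76, (1.3)–(1.9) p.77; [II] =
[Balaban1984PropagatorsII] (2.3) p.224; [III] = [Balaban1988Convergent] (2.2) p.255, (2.10)–(2.12) p.256, (2.18) p.257; [I] = [Balaban1987RG1] (0.1) p.251, (0.4) p.253.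
-/

noncomputable section

open scoped Matrix.Norms.L2Operator

namespace Literature.MathematicalPhysics.QuantumFieldTheory.Balaban1983to89.B11Thm1ExistsUniqueRealisedDataB

open T4Continuum B15DeterminingSets B15DeterminingSetsB GaugeField Node00
open B8Eq17ClassAkV1 (plaqsOf plaqsOf_mono)
open B14.Eq218Concrete (Seq)
open B11Thm1ExistsUniqueTokensGB (ApproxMinTopB ApproxMinimiserExistsTop7MGB ApproxMinimiserExistsCoP7MGB)
open B11Thm1ExistsUniqueInductionG (truncSeq truncSeq_Ω_of_le)

/-! ## §1  Accessors -/

section Access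

variable {P : Params} {G : Type*} [GaugeGroup G]
variable {av : ∀ j, Averaging P j G} {Ω : ℕ → Set (Site P 0)} {Ω₀ : Set (Site P 0)} {k : ℕ} {δ δ' : ℕ → ℝ} {W : MSField P G}

/-- (R): the datum is realised below the top. [cite: Balaban1988Convergent, (2.11) p.256; Balaban1985Variational, (11) p.279] -/
theorem DataRegularRealisedTop.real (h : DataRegularRealisedTop av Ω Ω₀ k δ W) {n : ℕ} (hn : n < k) : W (n + 1) = (av n).avg (W n) := h.1 n hn

/-- (F₀): the fine member on the plaquettes meeting the top domain. [cite: Balaban1985Variational, (2),(7) p.278; Balaban1985RegularSpaces, (1.7) p.77] -/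
theorem DataRegularRealisedTop.plaq₀ (h : DataRegularRealisedTop av Ω Ω₀ k δ W) : PlaqSmallOn (plaqsOf Ω₀) (δ 0) (W 0) := h.2.1

/-- (F₁): the fine member on the plaquettes meeting `Ω₁`, scale-`1` threshold. [cite: Balaban1985Variational, (14) p.280; Balaban1985RegularSpaces, (1.7) p.77] -/
theorem DataRegularRealisedTop.plaq₁ (h : DataRegularRealisedTop av Ω Ω₀ k δ W) : PlaqSmallOn (plaqsOf (Ω 1)) (δ 1) (W 0) := h.2.2.1

/-- (Fₙ): the level-`n` member on every level-`n` plaquette meeting `Ω_n^{(n)}`, `1 ≤ n ≤ k`. [cite: Balaban1985Variational, (7) p.278, (11) p.279] -/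
theorem DataRegularRealisedTop.plaqLevel (h : DataRegularRealisedTop av Ω Ω₀ k δ W) {n : ℕ} (h1 : 1 ≤ n) (hn : n ≤ k) :
    PlaqSmallOn (plaqsOf (pts n (Ω n))) (δ n) (W n) := h.2.2.2 n h1 hn

/-- Weakening the thresholds. [cite: Balaban1985Variational, (7) p.278 (bookkeeping)] -/
theorem DataRegularRealisedTop.of_le (h : DataRegularRealisedTop av Ω Ω₀ k δ W) (hδ : ∀ n, n ≤ k → δ n ≤ δ' n) (h1 : δ 1 ≤ δ' 1) :
    DataRegularRealisedTop av Ω Ω₀ k δ' W :=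
  ⟨h.1, fun p hp => (h.plaq₀ p hp).trans_le (hδ 0 (Nat.zero_le _)), fun p hp => (h.plaq₁ p hp).trans_le h1,
    fun n hn1 hn p hp => (h.plaqLevel hn1 hn p hp).trans_le (hδ n hn)⟩

end Access

/-! ## §2  Both readings of (7) follow -/

section Readings

variable {P : Params} {G : Type*} [GaugeGroup G]

/-- For `j ≥ 1` the plaquettes meeting the member `Γ_j^{(j)}` of [III] (2.2) are among the plaquettes meeting `Ω_j^{(j)}` (`Γ_j ⊆ Ω_j` at every positive level).
[cite: Balaban1988Convergent, (2.2) p.255; Balaban1985RegularSpaces, (1.5) p.77] -/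
theorem plaqsOf_genSet_subset_plaqsOf_pts (Ω : ℕ → Set (Site P 0)) (k : ℕ) {j : ℕ} (hj : 1 ≤ j) : plaqsOf (genSet Ω k j) ⊆ plaqsOf (pts j (Ω j)) := by
  refine plaqsOf_mono fun y hy => ?_
  simp only [genSet, mem_pts, gammaRegion] at hy ⊢
  split_ifs at hy with h1 h2 h3
  · exact absurd hy (Set.notMem_empty _)
  · subst h2; exact hy
  · omega
  · exact hy.1

variable {av : ∀ j, Averaging P j G} {Ω : ℕ → Set (Site P 0)} {Ω₀ : Set (Site P 0)} {k : ℕ} {δ : ℕ → ℝ} {W : MSField P G}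

/-- For a realised level the (b)-spliced (7) field IS the datum: `V̄ = M(W_m) = W_{m+1}` on every bond. [cite: Balaban1985Variational, (7) p.278 L26–33; Balaban1988Convergent, (2.11) p.256] -/
theorem mixedField_eq_of_real {m : ℕ} (S : Set (Site P (m + 1))) (hW : W (m + 1) = (av m).avg (W m)) :
    Sect2.mixedField av S (W (m + 1)) (W m) = W (m + 1) := by
  funext b
  by_cases hb : b ∈ bondsOf S
  · exact Sect2.mixedField_of_mem av _ _ hb
  · rw [Sect2.mixedField_of_not_mem av _ _ hb, ← hW]

/-- For a realised level print's (α)-spliced (7) field IS the datum. [cite: Balaban1985Variational, (7) p.278 L26–33; Balaban1984PropagatorsII, (2.3) p.224; Balaban1988Convergent, (2.11) p.256] -/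
theorem mixedFieldB_eq_of_real {m : ℕ} (𝔅 : Set (PBond P (m + 1))) (hW : W (m + 1) = (av m).avg (W m)) :
    Sect2.mixedFieldB av 𝔅 (W (m + 1)) (W m) = W (m + 1) := by
  funext b
  by_cases hb : b ∈ 𝔅
  · exact Sect2.mixedFieldB_of_mem av _ _ hb
  · rw [Sect2.mixedFieldB_of_not_mem av _ _ hb, ← hW]

/-- ★ **REGULAR-REALISED DATA SATISFY THE RECORD's (b)-READING OF (7)** (`Sect2.DataSmall7PTop`): level 0 — the printed top range lies in `plaqsOf Ω₀`; level `m+1 ≤ k` — the (7) field is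
`W_{m+1}` (realised) and the printed range lies in `plaqsOf Ω_{m+1}^{(m+1)}`. [cite: Balaban1985Variational, (7) p.278 L20–33; Balaban1988Convergent, (2.10)–(2.11) p.256] -/
theorem DataRegularRealisedTop.toPTop (h : DataRegularRealisedTop av Ω Ω₀ k δ W) : Sect2.DataSmall7PTop av Ω Ω₀ k δ W := by
  refine ⟨fun p hp => h.plaq₀ p hp.2, fun m hm p hp => ?_⟩
  rw [mixedField_eq_of_real _ (h.real (by omega))]
  exact h.plaqLevel (Nat.succ_pos m) hm p
    (plaqsOf_genSet_subset_plaqsOf_pts Ω k (Nat.succ_pos m) (Sect2.printedPlaqs_subset_plaqsOf Ω k (m + 1) hp))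

/-- ★ **REGULAR-REALISED DATA SATISFY PRINT's (α)-READING OF (7)** (`Sect2.DataSmall7LamTop`). [cite: Balaban1985Variational, (7) p.278 L20–33; Balaban1984PropagatorsII, (2.3) p.224; Balaban1988Convergent, (2.11) p.256] -/
theorem DataRegularRealisedTop.toLamTop (h : DataRegularRealisedTop av Ω Ω₀ k δ W) : Sect2.DataSmall7LamTop av Ω Ω₀ k δ W := by
  refine ⟨fun p hp => h.plaq₀ p hp.2, fun m hm p hp => ?_⟩
  rw [mixedFieldB_eq_of_real _ (h.real (by omega))]
  exact h.plaqLevel (Nat.succ_pos m) hm p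
    (plaqsOf_genSet_subset_plaqsOf_pts Ω k (Nat.succ_pos m) (Sect2.lamPlaqs_subset_plaqsOf Ω k (m + 1) hp))

end Readings

section ReadingsRecord

variable {F : T4Family} {N : ℕ} [NeZero N]

/-- The record's (b)-data predicate is implied pointwise (the `himp` of every `.of_imp_dat`). [cite: Balaban1985Variational, (7) p.278; Balaban1988Convergent, (2.11) p.256] -/
theorem dataSmall7PTopOf_of_dataRegularRealisedTopOf (K : ℕ) (Ω : ℕ → Set (Site (F.P K) 0)) (Ω₀ : Set (Site (F.P K) 0)) (k : ℕ) (δ : ℕ → ℝ)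
    (W : MSField (F.P K) (SU N)) (h : dataRegularRealisedTopOf F N K Ω Ω₀ k δ W) : dataSmall7PTopOf F N K Ω Ω₀ k δ W :=
  DataRegularRealisedTop.toPTop h

/-- Print's (α)-data predicate is implied pointwise. [cite: Balaban1985Variational, (7) p.278; Balaban1984PropagatorsII, (2.3) p.224] -/
theorem dataSmall7LamTopOf_of_dataRegularRealisedTopOf (K : ℕ) (Ω : ℕ → Set (Site (F.P K) 0)) (Ω₀ : Set (Site (F.P K) 0)) (k : ℕ) (δ : ℕ → ℝ)
    (W : MSField (F.P K) (SU N)) (h : dataRegularRealisedTopOf F N K Ω Ω₀ k δ W) : dataSmall7LamTopOf F N K Ω Ω₀ k δ W :=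
  DataRegularRealisedTop.toLamTop h

end ReadingsRecord

/-! ## §3  Heredity under print's truncation -/

section Trunc

variable {P : Params} {G : Type*} [GaugeGroup G] {D : ℕ → Set (Set (Site P 0))} {k : ℕ}
variable {av : ∀ j, Averaging P j G} {Ω₀ : Set (Site P 0)} {δ : ℕ → ℝ} {W : MSField P G}

/-- ★ **(11) FOR `V₀ := V`: REGULAR-REALISED DATA OF THE FULL INDEX ARE REGULAR-REALISED DATA OF THE TRUNCATED INDEX, SAME THRESHOLDS** (`1 ≤ k`; the truncation keeps `Ω_j`, `j ≤ k`).
[cite: Balaban1985Variational, (11) p.279; Balaban1988Convergent, (2.2) p.255, (2.18) p.257] -/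
theorem DataRegularRealisedTop.truncSeq (s : Seq D (k + 1)) (hk : 1 ≤ k) (h : DataRegularRealisedTop av s.Ω Ω₀ (k + 1) δ W) :
    DataRegularRealisedTop av (truncSeq s).Ω Ω₀ k δ W := by
  refine ⟨fun n hn => h.real (by omega), h.plaq₀, ?_, fun n hn1 hn => ?_⟩
  · rw [truncSeq_Ω_of_le s hk]; exact h.plaq₁
  · rw [truncSeq_Ω_of_le s hn]; exact h.plaqLevel hn1 (by omega)

end Trunc

/-! ## §4  The co-divergence through the stencil -/

section Stencil

variable {P : Params} {j : ℕ} {N : ℕ} [NeZero N]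

/-- `(x − e_ν) + e_μ = (x + e_μ) − e_ν`. [folklore] -/
private theorem unshift_shift_comm' (x : Site P j) (μ ν : Fin P.d) : (x.unshift ν).shift μ = (x.shift μ).unshift ν := by
  funext κ
  by_cases hμ : κ = μ <;> by_cases hν : κ = ν
  · subst hμ; subst hν; simp [Site.shift, Site.unshift]
  · subst hμ; simp [Site.shift, Site.unshift, Function.update_of_ne hν]
  · subst hν; simp [Site.shift, Site.unshift, Function.update_of_ne hμ]
  · simp [Site.shift, Site.unshift, Function.update_of_ne hμ, Function.update_of_ne hν]

/-- ★ **[6] (1.9) ON THE BONDS MEETING `S` FROM (1.7) ON THE PLAQUETTES MEETING `S`**: if `|U(∂p) − 1| < m` on every plaquette meeting `S`, then `‖η·(D^{η*}_U∂U)(b)‖ < t` on every bond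
meeting `S` as soon as `2d·m < t` — every stencil plaquette of a bond contains both its end-points, one of which is in `S` (`Node00.Sect2.norm_coDivSum_le_of_stencil`).
[cite: Balaban1985RegularSpaces, (1.1)–(1.2) p.76, (1.7),(1.9) p.77] -/
theorem coDivSmallOn_bondsOf_of_plaqSmallOn_plaqsOf {S : Set (Site P j)} {m t : ℝ} (hm : 0 ≤ m) {U : GaugeField P j (SU N)}
    (hU : PlaqSmallOn (plaqsOf S) m U) (ht : (P.d : ℝ) * (2 * m) < t) : Sect2.CoDivSmallOn (bondsOf S) t U := by
  intro b hb
  refine (Sect2.norm_coDivSum_le_of_stencil U hm b.src b.dir (fun ν h => ⟨?_, ?_⟩) (fun ν h => ⟨?_, ?_⟩)).trans_lt ht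
  · -- `p_{νμ}(x − e_ν)`: corners `x − e_ν`, `x`, `(x − e_ν) + e_μ`, `x + e_μ`
    refine (hU _ ?_).le
    rcases hb with h0 | h0
    · exact Or.inr (Or.inl (by show (b.src.unshift ν).shift ν ∈ S; rw [Site.shift_unshift]; exact h0))
    · refine Or.inr (Or.inr (Or.inr ?_))
      show ((b.src.unshift ν).shift ν).shift b.dir ∈ S
      rw [Site.shift_unshift]; exact h0
  · -- `p_{νμ}(x)`: corners `x`, `x + e_ν`, `x + e_μ`, …
    refine (hU _ ?_).le
    rcases hb with h0 | h0
    · exact Or.inl h0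
    · exact Or.inr (Or.inr (Or.inl h0))
  · -- `p_{μν}(x − e_ν)`: corners `x − e_ν`, `(x − e_ν) + e_μ`, `x`, `x + e_μ`
    refine (hU _ ?_).le
    rcases hb with h0 | h0
    · exact Or.inr (Or.inr (Or.inl (by show (b.src.unshift ν).shift ν ∈ S; rw [Site.shift_unshift]; exact h0)))
    · refine Or.inr (Or.inr (Or.inr ?_))
      show ((b.src.unshift ν).shift b.dir).shift ν ∈ S
      rw [unshift_shift_comm', Site.shift_unshift]; exact h0
  · -- `p_{μν}(x)`: corners `x`, `x + e_μ`, …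
    refine (hU _ ?_).le
    rcases hb with h0 | h0
    · exact Or.inl h0
    · exact Or.inr (Or.inl h0)

end Stencil

/-! ## §5  The SUPPLY token at length 1 over `(lamDatum F, dataRegularRealisedTopOf F N)` — «we take simply U₀ = V₀» -/

section Supply

variable {F : T4Family} {N : ℕ} [NeZero N]

/-- `η_0 = 1`, `η_1 = L⁻¹`. [cite: Balaban1987RG1, (1.1) p.260 (bookkeeping)] -/
private theorem eta_zero_one (K : ℕ) : (F.P K).eta 0 = 1 ∧ (F.P K).eta 1 = ((F.P K).L : ℝ)⁻¹ := by
  simp [Params.eta]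

/-- ★★ **(14) AT LENGTH 1 FOR `U₀ := W 0`, REGULAR-REALISED DATA** — print's *«for k = 1 … we take simply U₀ = V₀»* (p. 280) at print's [II] (2.3) datum: for an index `Ω` with one level, a
top domain `Ω₀`, thresholds `0 < δ₀, δ₁`, and regular-realised `W`, the fine member `W 0` is an approximate minimiser with (14) at `ρ := C₁B₃δ` over `Λ(Ω, 1)` as soon
as `8L³ < C₁B₃` (`d = 4`): plaquettes at scale 0 on `plaqsOf Ω₀` by (F₀), at scale 1 on `plaqsOf Ω₁` by (F₁) (`η₁ = L⁻¹`, `L² ≤ C₁B₃`); co-divergences by §4 (`2d·δ < C₁B₃δη³`); agreement at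
level 0 (`M⁰ = id`) and at level 1 by (R) (`M(W 0) = W 1`), nothing above.
[cite: Balaban1985Variational, (14) p.280, (11) p.279, (2)–(3) p.278; Balaban1985RegularSpaces, (1.7)–(1.9) p.77; Balaban1984PropagatorsII, (2.3) p.224; Balaban1988Convergent, (2.10)–(2.11) p.256] -/
theorem approxMinTopB_lengthOne_of_realised (K : ℕ) (Ω : ℕ → Set (Site (F.P K) 0)) (Ω₀ : Set (Site (F.P K) 0)) {C₁ B₃ : ℝ} {δ : ℕ → ℝ}
    (hCB : 8 * (F.L : ℝ) ^ 3 < C₁ * B₃) (hδ0 : 0 < δ 0) (hδ1 : 0 < δ 1)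
    {W : MSField (F.P K) (SU N)} (hW : DataRegularRealisedTop (avOfRecord F N K) Ω Ω₀ 1 δ W) :
    ApproxMinTopB (avOfRecord F N K) Ω Ω₀ 1 (fun n => C₁ * B₃ * δ n) (lamBondsSeq Ω 1) W (W 0) := by
  obtain ⟨hη0, hη1⟩ := eta_zero_one (F := F) K
  have hL1 : (1 : ℝ) ≤ F.L := by exact_mod_cast (show 1 ≤ F.L by have := F.hL.2; omega)
  have hL0 : (0 : ℝ) < F.L := by linarith
  have hLK : ((F.P K).L : ℝ) = F.L := rfl
  have hd : ((F.P K).d : ℝ) = 4 := by rw [T4Family.P_d]; norm_num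
  have hL3 : (1 : ℝ) ≤ (F.L : ℝ) ^ 3 := one_le_pow₀ hL1
  have hCB8 : 8 < C₁ * B₃ := lt_of_le_of_lt (by nlinarith) hCB
  have hCB2 : (F.L : ℝ) ^ 2 * 2 ≤ C₁ * B₃ := by nlinarith [pow_le_pow_right₀ hL1 (show 2 ≤ 3 by norm_num)]
  refine ⟨fun n hn => ?_, fun n hn => ?_, fun j b hb => ?_⟩
  · -- plaquettes
    rcases Nat.le_one_iff_eq_zero_or_eq_one.mp hn with rfl | rfl
    · rw [Sect2.omegaPlaqsTop_zero, hη0]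
      intro p hp
      refine (hW.plaq₀ p hp).trans_le ?_
      nlinarith
    · rw [Sect2.omegaPlaqsTop_of_ne_zero Ω Ω₀ one_ne_zero, omegaPlaqs_of_ne_zero Ω one_ne_zero, hη1, hLK]
      intro p hp
      refine (hW.plaq₁ p hp).trans_le ?_
      rw [inv_pow, ← div_eq_mul_inv, le_div_iff₀ (by positivity)]
      nlinarith
  · -- co-divergences through the stencil
    rcases Nat.le_one_iff_eq_zero_or_eq_one.mp hn with rfl | rfl
    · rw [Sect2.omegaBondsTop_zero, hη0]
      refine coDivSmallOn_bondsOf_of_plaqSmallOn_plaqsOf hδ0.le hW.plaq₀ ?_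
      rw [hd]; nlinarith
    · rw [Sect2.omegaBondsTop_of_ne_zero Ω Ω₀ one_ne_zero]
      unfold Sect2.omegaBonds
      rw [if_neg one_ne_zero, hη1, hLK]
      refine coDivSmallOn_bondsOf_of_plaqSmallOn_plaqsOf hδ1.le hW.plaq₁ ?_
      rw [hd, inv_pow, ← div_eq_mul_inv, lt_div_iff₀ (by positivity)]
      nlinarith
  · -- agreement on `Λ(Ω, 1)`: level 0 by `M⁰ = id`, level 1 by (R), nothing above
    rcases Nat.lt_trichotomy j 1 with hj | rfl | hj
    · obtain rfl : j = 0 := by omega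
      rfl
    · show (avOfRecord F N K 0).avg (W 0) b = W 1 b
      rw [hW.real Nat.one_pos]
    · exfalso
      rw [lamBondsSeq_of_gt Ω 1 hj] at hb
      exact hb

/-- ★★ **THE SUPPLY TOKEN AT LENGTH 1 OVER `(lamDatum F, dataRegularRealisedTopOf F N)`, ANY SELECTOR, ANY GUARD** — the `hbase` input of print's induction
(`…TokensGBBridges.variationalThm1EUSepTop7MGB_of_step_of_reg_of_base_of_lift`): under the guard `Adm ∧ k = 1` an approximate minimiser with (14) at `C₁B₃δ` EXISTS for every
regular-realised datum (`U₀ := W 0`), whenever `8L³ < C₁B₃`. [cite: Balaban1985Variational, (11) p.279, (14) p.280; Balaban1984PropagatorsII, (2.3) p.224; Balaban1985RegularSpaces, (1.7)–(1.9) p.77] -/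
theorem approxMinimiserExistsTop7MGB_lengthOne_realised
    (Sup : (ν : Stage7Numerics) → (K : ℕ) → (ℕ → Set (Site (F.P K) 0)) → Set (Site (F.P K) 0)) (Adm : StepGuard F) {C₁ B₃ a₀ a₁ : ℝ}
    (hCB : 8 * (F.L : ℝ) ^ 3 < C₁ * B₃) :
    ApproxMinimiserExistsTop7MGB F N Sup (fun ν M g K k s => Adm ν M g K k s ∧ k = 1) (lamDatum F) (dataRegularRealisedTopOf F N) C₁ B₃ a₀ a₁ := by
  intro ν M g K k s _hk _hsep _hM hadm ε₀ δ hnum _hc _hc' _hε W hW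
  obtain ⟨-, rfl⟩ := hadm
  exact ⟨W 0, approxMinTopB_lengthOne_of_realised K s.Ω (Sup ν K s.Ω) hCB (hnum 0 (Nat.zero_le _)).1 (hnum 1 le_rfl).1 hW⟩

/-- ★★ **`CoP` EDITION — THE SUPPLY TOKEN AT LENGTH 1 ON THE SUPPORT OF RECORD**, regular-realised data, any guard. [cite: Balaban1985Variational, (11) p.279, (14) p.280; Balaban1988Convergent, p.255, (2.12) p.256] -/
theorem approxMinimiserExistsCoP7MGB_lengthOne_realised (Adm : StepGuard F) {C₁ B₃ a₀ a₁ : ℝ} (hCB : 8 * (F.L : ℝ) ^ 3 < C₁ * B₃) :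
    ApproxMinimiserExistsCoP7MGB F N (fun ν M g K k s => Adm ν M g K k s ∧ k = 1) (lamDatum F) (dataRegularRealisedTopOf F N) C₁ B₃ a₀ a₁ :=
  approxMinimiserExistsTop7MGB_lengthOne_realised (fun ν K Ω => suppDomOfRecord F ν K Ω) Adm hCB

end Supply

end Literature.MathematicalPhysics.QuantumFieldTheory.Balaban1983to89.B11Thm1ExistsUniqueRealisedDataB

end
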